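import Summits.BirchSwinnertonDyer.BirchSwinnertonDyer.Theses.SylvesterTwoHeegnerIndex
import Summits.BirchSwinnertonDyer.Rank1Residual.X12.CubeSumSylvesterOddPart
import Summits.BirchSwinnertonDyer.Rank1Residual.X12.CubicModelKodaira
import Literature.NumberTheory.EllipticCurves.RootNumberTableThreeKodairaProofs
import Literature.NumberTheory.EllipticCurves.RootNumberTableThreeKodairaRowsProofs
import Literature.NumberTheory.EllipticCurves.QuadraticTwistTateFormTwoProofs
import Literature.NumberTheory.GaloisRepresentations.HeckeCharacterProofs
import HarnessLib

/-!
# Route `SylvesterTwoHeegnerIndex` (rung K7t): the LOCAL TYPES of the Sylvester curves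
# `E_p : x³ + y³ = p` — Kodaira `IV` at `p`, and at `3`: `III*` if `p ≡ 7 (mod 9)`, `IV*` if
# `p ≡ 4 (mod 9)` — for EVERY model, by Tate's algorithm run in the kernel

Cell `b2b-bsdres`, unit `b2b-bsdres-x1b` (X12 prover owner / O12 class lead, gen 47). HONEST FRAMING
(verbatim in every file of the cell): the cell DELETES the combination-shaped residual classes of the
BSD formula in analytic rank `≤ 1` from PUBLISHED theorems only and TYPES the construction-shaped ones;
O12 (CM at `p = 2`) is CONSTRUCTION-SHAPED and stays so; tool theorems only; nothing booked; no label
moves. Support lemmas «on demand» named by the route text of `Theses/SylvesterTwoHeegnerIndex.lean`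
("the exact `2`-adic constants (Manin, `u`, Tamagawa at `2` and `3` for `x³ + y³ = p`) are support
lemmas on demand"): the Tamagawa factor `c_W = c₃(E_p)·c_p(E_p)` of `P2.cmHeegnerIndexQuotient` is read
off the Kodaira symbols at the two bad places `3` and `p` (Δ_min = −3⁹p⁴, `X12.Sylvester.good_of_model`);
this file computes those symbols for the whole family, in the kernel, with NO named fact:
* §1 the invariants of x1b's minimal model `X12.Sylvester.sylvesterCurve p = [0, 0, p, 0, −7p²]`:
  `c₄ = 0`, `c₆ = 2³·3⁶·p²`, `Δ = −3⁹·p⁴`;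
* §2 THE PLACE `3` (wild): Rizzo's Table II (= Papadopoulos 1993 Table III at `p = 3`), which the tree
  PROVES equal to Tate's algorithm (`WeierstrassCurve.kodairaSymbolAt_eq_tableKodairaSymbolThree_of_primesEquiv_eq`,
  team n1011 ROW T-PAP3-KOD), read on the reduced triple `(v₃ c₄, v₃ c₆, v₃ Δ) = (∞, 6, 9)` with
  `c₆' = 8p² (mod 9)`: the special condition `c₆'² + 2 ≡ 3c_{4,4} = 0 (mod 9)` holds iff `p ≡ 7 (mod 9)`
  (`c₆' ≡ 5`) and fails iff `p ≡ 4 (mod 9)` (`c₆' ≡ 2`) — `kodairaSymbolAt_three_of_model_of_mod_nine_eq_seven :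
  … = .IIIstar`, `kodairaSymbolAt_three_of_model_of_mod_nine_eq_four : … = .IVstar`, for EVERY model of `E_p`
  (`kodairaSymbolAt_smul'`);
* §3 THE PLACE `p` (tame, `p ≥ 5`): x1b's engine `X12.kodairaSymbolAt_of_cubic_model` on the model
  `cubeSumCurve p = (y² = x³ − 432p²)`, `ord_p(432p²) = 2` ⟹ `kodairaSymbolAt_self_of_model : … = .IV`.
CONSEQUENCE (stated in §4 as a remark-level corollary on the Kodaira side only): the component groups have
orders `#Φ₃ = 2` (`III*`) resp. `3` (`IV*`) and `#Φ_p = 3` (`IV`), so the `2`-part of the Tamagawa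
product of `E_p` is `2^{[p ≡ 7 (9)]}` once `c_v` is read off the symbol (the tree's Kodaira→Tamagawa
links are named facts of `NeronComponentDataAssembly`; PARI confirms `c₃ = 2 / 1`, `c_p = 3` on every
`p ≡ 4, 7 (9)` up to `373`, kit j248952 — EVIDENCE, not used). Not here: Tamagawa numbers themselves,
the place `2` (good, `X12.Sylvester.good_of_model`), anything about the cruxes.

References: O. G. Rizzo, Compositio Math. 136 (2003) Table II; I. Papadopoulos, J. Number Theory 44 (1993)
Table III; J. H. Silverman, *ATAEC* IV.9.4 and Table 4.1; HOME `b2b-bsdres-x1b/X12-ROUTE.md` §51.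
-/

set_option autoImplicit false
set_option linter.dupNamespace false

noncomputable section

open scoped Classical NumberField

open WeierstrassCurve NumberField IsDedekindDomain IsDedekindDomain.HeightOneSpectrum
  Rat.HeightOneSpectrum Literature.NumberTheory.EllipticCurves
  Literature.NumberTheory.EllipticCurves.HuShuYin2019
  Literature.NumberTheory.EllipticCurves.Rizzo
  Literature.NumberTheory.DiophantineGeometry
  Literature.NumberTheory.GaloisRepresentations
  Summit.BirchSwinnertonDyer.Rank1Residual.X12.Sylvester

namespace Summit.BirchSwinnertonDyer.BirchSwinnertonDyer.Theorems.SylvesterTwoLocalTypes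

/-! ## §1 Invariants of the minimal model `[0, 0, p, 0, −7p²]` -/

/-- `c₄(sylvesterCurve p) = 0` (`j = 0`). [cite: SilvermanAEC2009, III.1] -/
theorem sylvesterCurve_c₄ (p : ℕ) : (sylvesterCurve p).c₄ = 0 := by
  simp [sylvesterCurve, WeierstrassCurve.c₄, WeierstrassCurve.b₂, WeierstrassCurve.b₄]

/-- `c₆(sylvesterCurve p) = 5832·p² = 2³·3⁶·p²`. [cite: SilvermanAEC2009, III.1] -/
theorem sylvesterCurve_c₆ (p : ℕ) : (sylvesterCurve p).c₆ = 5832 * (p : ℚ) ^ 2 := by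
  simp only [sylvesterCurve, WeierstrassCurve.c₆, WeierstrassCurve.b₂, WeierstrassCurve.b₄,
    WeierstrassCurve.b₆]
  ring

/-- `Δ(sylvesterCurve p) = −19683·p⁴ = −3⁹·p⁴`. [cite: SilvermanAEC2009, III.1] -/
theorem sylvesterCurve_Δ (p : ℕ) : (sylvesterCurve p).Δ = -(19683 * (p : ℚ) ^ 4) := by
  simp only [sylvesterCurve, WeierstrassCurve.Δ, WeierstrassCurve.b₂, WeierstrassCurve.b₄,
    WeierstrassCurve.b₆, WeierstrassCurve.b₈]
  ring

/-! ## §2 The place `3`: Rizzo's Table II on the reduced triple `(∞, 6, 9)` -/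

section Three

variable {p : ℕ}

/-- `padicValRat 3 p = 0` for a prime `p ≠ 3`. [folklore] -/
theorem padicValRat_three_prime (hp : p.Prime) (hp3 : p ≠ 3) : padicValRat 3 (p : ℚ) = 0 := by
  rw [padicValRat.of_nat, Nat.cast_eq_zero]
  refine padicValNat.eq_zero_of_not_dvd fun h ↦ hp3 ?_
  exact ((Nat.prime_dvd_prime_iff_eq Nat.prime_three hp).mp h).symm

/-- `padicValRat 3 8 = 0`. [folklore] -/
theorem padicValRat_three_eight : padicValRat 3 (8 : ℚ) = 0 := by
  rw [show (8 : ℚ) = ((8 : ℕ) : ℚ) by norm_num, padicValRat.of_nat, Nat.cast_eq_zero]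
  exact padicValNat.eq_zero_of_not_dvd (by norm_num)

/-- `v₃(c₆) = 6` (`c₆ = 3⁶·8p²`, `p ≠ 3`). [folklore] -/
theorem padicValRat_three_c₆ (hp : p.Prime) (hp3 : p ≠ 3) :
    padicValRat 3 (sylvesterCurve p).c₆ = 6 := by
  haveI : Fact (Nat.Prime 3) := ⟨Nat.prime_three⟩
  have hp0 : (p : ℚ) ≠ 0 := Nat.cast_ne_zero.mpr hp.ne_zero
  rw [sylvesterCurve_c₆, show (5832 : ℚ) * (p : ℚ) ^ 2 = (3 : ℚ) ^ 6 * (8 * (p : ℚ) ^ 2) by ring,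
    padicValRat.mul (pow_ne_zero _ (by norm_num)) (mul_ne_zero (by norm_num) (pow_ne_zero _ hp0)),
    padicValRat.pow, padicValRat.mul (by norm_num) (pow_ne_zero _ hp0), padicValRat.pow,
    padicValRat_three_prime hp hp3, padicValRat_three_eight,
    show (3 : ℚ) = ((3 : ℕ) : ℚ) by norm_num, padicValRat.self (by norm_num)]
  norm_num

/-- `v₃(Δ) = 9` (`Δ = −3⁹·p⁴`, `p ≠ 3`). [folklore] -/
theorem padicValRat_three_Δ (hp : p.Prime) (hp3 : p ≠ 3) :
    padicValRat 3 (sylvesterCurve p).Δ = 9 := by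
  haveI : Fact (Nat.Prime 3) := ⟨Nat.prime_three⟩
  have hp0 : (p : ℚ) ≠ 0 := Nat.cast_ne_zero.mpr hp.ne_zero
  rw [sylvesterCurve_Δ, padicValRat.neg, show (19683 : ℚ) = (3 : ℚ) ^ 9 by norm_num,
    padicValRat.mul (pow_ne_zero _ (by norm_num)) (pow_ne_zero _ hp0),
    padicValRat.pow, padicValRat.pow, padicValRat_three_prime hp hp3,
    show (3 : ℚ) = ((3 : ℕ) : ℚ) by norm_num, padicValRat.self (by norm_num)]
  norm_num

/-- `v₃(c₄) = ∞` in the table's `WithTop ℤ` (`c₄ = 0`). [cite: Rizzo2003, §1.1 (p. 3)] -/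
theorem val3_c₄ (p : ℕ) : val3 (sylvesterCurve p).c₄ = ⊤ := by
  rw [sylvesterCurve_c₄, val3, if_pos rfl]

/-- `v₃(c₆) = 6` in the table's `WithTop ℤ`. [cite: Rizzo2003, §1.1 (p. 3)] -/
theorem val3_c₆ (hp : p.Prime) (hp3 : p ≠ 3) :
    val3 (sylvesterCurve p).c₆ = ((6 : ℤ) : WithTop ℤ) := by
  have hne : (sylvesterCurve p).c₆ ≠ 0 := by
    rw [sylvesterCurve_c₆]
    exact mul_ne_zero (by norm_num) (pow_ne_zero _ (Nat.cast_ne_zero.mpr hp.ne_zero))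
  rw [val3, if_neg hne, padicValRat_three_c₆ hp hp3]

/-- The prime-to-`3` part of `c₆` is the INTEGER `8p²`. [cite: Rizzo2003, p. 2 (notation x')] -/
theorem primeToThreePart_c₆ (hp : p.Prime) (hp3 : p ≠ 3) :
    primeToThreePart (sylvesterCurve p).c₆ = ((8 * (p : ℤ) ^ 2 : ℤ) : ℚ) := by
  rw [primeToThreePart, padicValRat_three_c₆ hp hp3, sylvesterCurve_c₆]
  push_cast
  ring

/-- `c₆' ≡ 8p² (mod 9)` as the table reads it (`res9`). [cite: Rizzo2003, p. 2 and Table II] -/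
theorem res9_c₆ (hp : p.Prime) (hp3 : p ≠ 3) :
    res9 (sylvesterCurve p).c₆ = (8 * (p : ℤ) ^ 2) % 9 := by
  rw [res9, primeToThreePart_c₆ hp hp3]
  simp only [Rat.den_intCast, Rat.num_intCast, if_true]

/-- `8p² ≡ 5 (mod 9)` for `p ≡ 7 (mod 9)` (`p² ≡ 4`). [folklore] -/
theorem eight_mul_sq_emod_nine_of_seven (h : p % 9 = 7) : (8 * (p : ℤ) ^ 2) % 9 = 5 := by
  have h' : (p : ℤ) % 9 = 7 := by exact_mod_cast h
  rw [pow_two, Int.mul_emod, Int.mul_emod (p : ℤ) (p : ℤ), h']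
  norm_num

/-- `8p² ≡ 2 (mod 9)` for `p ≡ 4 (mod 9)` (`p² ≡ 7`). [folklore] -/
theorem eight_mul_sq_emod_nine_of_four (h : p % 9 = 4) : (8 * (p : ℤ) ^ 2) % 9 = 2 := by
  have h' : (p : ℤ) % 9 = 4 := by exact_mod_cast h
  rw [pow_two, Int.mul_emod, Int.mul_emod (p : ℤ) (p : ℤ), h']
  norm_num

/-- A prime `p ≡ 4` or `7 (mod 9)` is not `3`. [folklore] -/
theorem ne_three_of_mod_nine (h9 : p % 9 = 4 ∨ p % 9 = 7) : p ≠ 3 := by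
  rintro rfl; omega

/-- **Table II on `[0, 0, p, 0, −7p²]`, `p ≡ 7 (mod 9)`: row `(≥4, 6, 9)` WITH the special condition
(`c₆' ≡ 5`, `5² + 2 = 27 ≡ 0 = 3c_{4,4}`): Kodaira `III*`.** [cite: Rizzo2003, Table II (p. 4), row (≥4,6,9)]
[cite: Papadopoulos1993, Table III (p = 3)] -/
theorem tableKodairaSymbolThree_of_mod_nine_eq_seven (hp : p.Prime) (h9 : p % 9 = 7) :
    (sylvesterCurve p).tableKodairaSymbolThree = .IIIstar := by
  have hp3 : p ≠ 3 := ne_three_of_mod_nine (Or.inr h9)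
  rw [tableKodairaSymbolThree, kodairaOfInvariants_eq_of_shift_zero (a := ⊤) (b := ((6 : ℤ) : WithTop ℤ))
    (c := 9) (k := 0) (by rw [val3_c₄]; rfl) (by rw [val3_c₆ hp hp3]; simp)
    (by rw [padicValRat_three_Δ hp hp3]; norm_num) (by decide), res9_c₆ hp hp3,
    eight_mul_sq_emod_nine_of_seven h9]
  refine kodaira_row_ge4_6_9_of_sp (a := ⊤) rfl _ _ _ ?_
  have hc : c4e ⊤ (res9 (sylvesterCurve p).c₄) 4 = 0 := rfl
  rw [hc]; decide

/-- **Table II on `[0, 0, p, 0, −7p²]`, `p ≡ 4 (mod 9)`: row `(≥5, 6, 9)` WITHOUT the special condition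
(`c₆' ≡ 2`, `2² + 2 = 6 ≢ 0`; corrected clause `c₆' ≢ ±4`): Kodaira `IV*`.**
[cite: Rizzo2003, Table II (p. 4), row (≥5,6,9)] [cite: Varillyalvarado2011, Rem. 4.2]
[cite: Papadopoulos1993, Table III (p = 3)] -/
theorem tableKodairaSymbolThree_of_mod_nine_eq_four (hp : p.Prime) (h9 : p % 9 = 4) :
    (sylvesterCurve p).tableKodairaSymbolThree = .IVstar := by
  have hp3 : p ≠ 3 := ne_three_of_mod_nine (Or.inl h9)
  rw [tableKodairaSymbolThree, kodairaOfInvariants_eq_of_shift_zero (a := ⊤) (b := ((6 : ℤ) : WithTop ℤ))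
    (c := 9) (k := 0) (by rw [val3_c₄]; rfl) (by rw [val3_c₆ hp hp3]; simp)
    (by rw [padicValRat_three_Δ hp hp3]; norm_num) (by decide), res9_c₆ hp hp3,
    eight_mul_sq_emod_nine_of_four h9]
  refine kodaira_row_ge5_6_9_of_not_sp (a := ⊤) rfl WithTop.top_ne_coe _ _ _ ?_ (by decide)
  have hc : c4e ⊤ (res9 (sylvesterCurve p).c₄) 4 = 0 := rfl
  rw [hc]; decide

/-- **KODAIRA TYPE AT `3` OF `E_p`, `p ≡ 7 (mod 9)`: `III*`** — for EVERY model `B ≅_ℚ E_p` and the place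
`v ∣ 3` (Tate's algorithm = Table II, `kodairaSymbolAt_eq_tableKodairaSymbolThree_of_primesEquiv_eq`;
model-independence `kodairaSymbolAt_smul'`). [cite: Rizzo2003, Table II (p. 4)] [cite: Papadopoulos1993, Table III (p = 3)]
[cite: Silverman1994, IV.9.4 and Table 4.1] -/
theorem kodairaSymbolAt_three_of_model_of_mod_nine_eq_seven (hp : p.Prime) (h9 : p % 9 = 7)
    (B : WeierstrassCurve ℚ) [B.IsElliptic] (hB : ∃ C : VariableChange ℚ, C • B = cubeSumCurve (p : ℚ))
    (v : HeightOneSpectrum (𝓞 ℚ)) (hv : natGenerator v = 3) : B.kodairaSymbolAt v = .IIIstar := by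
  obtain ⟨C, hC⟩ := hB
  haveI := isElliptic_sylvesterCurve hp.ne_zero
  have hBs : (C⁻¹ * sylvesterScale p) • sylvesterCurve p = B := by
    rw [mul_smul, sylvesterScale_smul, ← hC, inv_smul_smul]
  rw [← hBs, kodairaSymbolAt_smul',
    kodairaSymbolAt_eq_tableKodairaSymbolThree_of_primesEquiv_eq v (sylvesterCurve p) hv]
  exact tableKodairaSymbolThree_of_mod_nine_eq_seven hp h9

/-- **KODAIRA TYPE AT `3` OF `E_p`, `p ≡ 4 (mod 9)`: `IV*`** — for EVERY model `B ≅_ℚ E_p` and the place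
`v ∣ 3`. [cite: Rizzo2003, Table II (p. 4)] [cite: Papadopoulos1993, Table III (p = 3)]
[cite: Silverman1994, IV.9.4 and Table 4.1] -/
theorem kodairaSymbolAt_three_of_model_of_mod_nine_eq_four (hp : p.Prime) (h9 : p % 9 = 4)
    (B : WeierstrassCurve ℚ) [B.IsElliptic] (hB : ∃ C : VariableChange ℚ, C • B = cubeSumCurve (p : ℚ))
    (v : HeightOneSpectrum (𝓞 ℚ)) (hv : natGenerator v = 3) : B.kodairaSymbolAt v = .IVstar := by
  obtain ⟨C, hC⟩ := hB
  haveI := isElliptic_sylvesterCurve hp.ne_zero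
  have hBs : (C⁻¹ * sylvesterScale p) • sylvesterCurve p = B := by
    rw [mul_smul, sylvesterScale_smul, ← hC, inv_smul_smul]
  rw [← hBs, kodairaSymbolAt_smul',
    kodairaSymbolAt_eq_tableKodairaSymbolThree_of_primesEquiv_eq v (sylvesterCurve p) hv]
  exact tableKodairaSymbolThree_of_mod_nine_eq_four hp h9

end Three

/-! ## §3 The place `p` (`p ≥ 5`): type `IV` -/

section Self

variable {p : ℕ}

/-- **KODAIRA TYPE AT `p` OF `E_p` (`p ≥ 5` prime): `IV`** — for EVERY model `B ≅_ℚ E_p` and the place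
`v ∣ p`: Tate's algorithm on `y² = x³ − 432p²` (`ord_p(432p²) = 2`, Step 5) via x1b's engine
`X12.kodairaSymbolAt_of_cubic_model`. [cite: SilvermanATAEC1994, IV.9.4 Step 5 and Table 4.1] -/
theorem kodairaSymbolAt_self_of_model (hp : p.Prime) (hp5 : 5 ≤ p)
    (B : WeierstrassCurve ℚ) [B.IsElliptic] (hB : ∃ C : VariableChange ℚ, C • B = cubeSumCurve (p : ℚ))
    (v : HeightOneSpectrum (𝓞 ℚ)) (hv : natGenerator v = p) : B.kodairaSymbolAt v = .IV := by
  obtain ⟨C, hC⟩ := hB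
  haveI : Fact p.Prime := ⟨hp⟩
  have hv2 : natGenerator v ≠ 2 := by rw [hv]; omega
  have hv3 : natGenerator v ≠ 3 := by rw [hv]; omega
  -- `ord_p (−432 p²) = 2`
  have h432 : ¬ (natGenerator v : ℤ) ∣ (-432 : ℤ) := by
    rw [hv, dvd_neg]
    intro h
    have h' : p ∣ 432 := by exact_mod_cast h
    have : p ∣ 2 ^ 4 * 3 ^ 3 := by norm_num at h' ⊢; exact h'
    rcases (Nat.Prime.dvd_mul hp).mp this with h2 | h3
    · have := (Nat.prime_dvd_prime_iff_eq hp Nat.prime_two).mp (hp.dvd_of_dvd_pow h2); omega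
    · have := (Nat.prime_dvd_prime_iff_eq hp Nat.prime_three).mp (hp.dvd_of_dvd_pow h3); omega
  have hval : v.valuation ℚ (-432 * (p : ℚ) ^ 2) = WithZero.exp (-((2 : ℕ) : ℤ)) := by
    rw [map_mul, map_pow, show ((p : ℚ)) = ((natGenerator v : ℕ) : ℚ) by rw [hv],
      Rat.valuation_natGenerator, show (-432 : ℚ) = ((-432 : ℤ) : ℚ) by norm_num,
      Rat.valuation_intCast_eq_one v h432, one_mul, ← WithZero.exp_nsmul]
    norm_num
  have hM : cubeSumCurve (p : ℚ) = C • B := hC.symm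
  have hMb : cubeSumCurve (p : ℚ) = ⟨0, 0, 0, 0, -432 * (p : ℚ) ^ 2⟩ := rfl
  rw [Summit.BirchSwinnertonDyer.Rank1Residual.X12.kodairaSymbolAt_of_cubic_model B v hv2 hv3 (cubeSumCurve (p : ℚ)) C hM hMb
    (s := 2) (by norm_num) (by norm_num) hval]
  rfl

end Self

/-! ## §4 On the class 𝒞_HSY: the dichotomy by `p mod 9`, for every member and every model -/

/-- **THE LOCAL TYPES OF 𝒞_HSY** (`p ≡ 4, 7 (mod 9)` prime; the cube condition on `3 mod p` is not needed):
for every model `B` of `E_p`, at the place over `p` the Kodaira symbol is `IV`, and at the place over `3` it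
is `IVstar` or `IIIstar` according as `p ≡ 4` or `7 (mod 9)` (component groups of order `3`; `3` or `2`).
Bookkeeping of §2–§3. [cite: Rizzo2003, Table II (p. 4)] [cite: SilvermanATAEC1994, IV.9.4 and Table 4.1] -/
theorem kodairaSymbolAt_of_model {p : ℕ} (hp : p.Prime) (h9 : p % 9 = 4 ∨ p % 9 = 7)
    (B : WeierstrassCurve ℚ) [B.IsElliptic] (hB : ∃ C : VariableChange ℚ, C • B = cubeSumCurve (p : ℚ))
    (v : HeightOneSpectrum (𝓞 ℚ)) :
    (natGenerator v = p → B.kodairaSymbolAt v = .IV) ∧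
    (natGenerator v = 3 → B.kodairaSymbolAt v = if p % 9 = 4 then .IVstar else .IIIstar) := by
  have hp5 : 5 ≤ p := by
    rcases h9 with h | h
    · by_contra hlt
      interval_cases p <;> simp_all (config := {decide := true})
    · by_contra hlt
      interval_cases p <;> simp_all (config := {decide := true})
  refine ⟨fun hv ↦ kodairaSymbolAt_self_of_model hp hp5 B hB v hv, fun hv ↦ ?_⟩
  rcases h9 with h | h
  · rw [if_pos h]; exact kodairaSymbolAt_three_of_model_of_mod_nine_eq_four hp h B hB v hv
  · rw [if_neg (by omega)]; exact kodairaSymbolAt_three_of_model_of_mod_nine_eq_seven hp h B hB v hv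

end Summit.BirchSwinnertonDyer.BirchSwinnertonDyer.Theorems.SylvesterTwoLocalTypes

end
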